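import Summits.QuantumFields.BalabanUV.Beta.RemainderExplicitHistoryDiagonalRateEverywhere
import Summits.QuantumFields.BalabanUV.Beta.RemainderExplicitHistoryDiagonalRatePowerTailOne

/-!
# RemainderExplicitHistoryDiagonalRatePowerTailAll — ROAD P3, ORDER-0 PROFILE FAMILY: THE RATE IN THE CUTOFF FOR EVERY SUMMABLE POWER TAIL
# `R(N) − R(k) ≤ T₀∕(k+1)^q`, ANY `q > 1` — the convolution shape (T2) holds with `A₂ = T₀·2^q·(2 + 1∕(q−1))` and the summed tail with
# `Ts = T₀∕(q−1)`, so by the second file `astar g m − invSq g m n ≤ Λ√m·T₀∕(n+2)^q` for ALL cutoffs `n` above a threshold in `m`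
# (`Λ = 4C_w∕√b` under `2Wγ < b`, `Λ = 8∕√b` under `Wγ < b`); with generation 49's minorant side (every `q ≥ 0`) the rate `√m∕n^q` is
# two-sided and pointwise for EVERY `q > 1` — the classes `q ≥ 2` of generation 50's census OPEN (ii′) included (third file of station
# S-d4p3-g51-1 «the tails alone buy the rate»)

Cell `pub-balaban`, β-function sub-cell, BINDER row D4 «RemainderConst leaves for Bałaban's split» (`HOME/BINDER-OWNERS.md`; owner
lineage `b2b-balaban-beta-an4`; this file by co-owner #3 lineage `b2b-balaban-beta-d4-p3`, road P3 «the reduction road», generation 51,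
station S-d4p3-g51-1, third file; imports the station's second file `RemainderExplicitHistoryDiagonalRateEverywhere` and generation 50's
`RemainderExplicitHistoryDiagonalRatePowerTailOne` (hence `…RatePowerProfileTwo`, `…RatePowerTailTwo`, `…RateUniform`)), β-FLOW TEAM duty (1);
FREEZE (0) honoured (def-free module in road P3's own `RemainderExplicit*` series; no leaf, no interface, no Literature file).  SOURCE OF
THE SHAPES ONLY: [Balaban1987RG1] (0.20) p. 256, (0.31) and Thm 2 p. 259, §5 p. 298.  Pure real analysis about ONE explicit toy family (ours,
not Bałaban's).

HONEST FRAMING (page 1 of everything the β sub-cell writes).  *"Discharging BetaPertH makes Bałaban's UV stability UNCONDITIONAL — a real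
constructive-QFT result; it is NOT the continuum limit and NOT the Clay problem."*  THIS FILE DISCHARGES NOTHING OF THE KIND.  Generations
49–50 priced the rate in the cutoff for power tails `0 < q < 2` through the pair of shape hypotheses (T1) ∕ (T2) of the third file of
S-d4p3-g49-1; (T1) is false for `q ≥ 2`.  The second file of this station removed (T1); what remains is the convolution shape (T2), which
holds for EVERY `q > 1` with `A₂ = T₀·2^q·(2 + 1∕(q−1))` (§2: generation 50's split at `j₀∕2` with the factor `2^q` kept instead of `≤ 4`; the
young half against the convergent `q`-series `Σ 1∕(i+1)^q ≤ 1 + 1∕(q−1)` — for `q ≤ 2` generation 50's Bernoulli bound, for `q ≥ 2` the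
telescoped `(1+q′)`-tail of `…RatePowerProfileTwo.sum_Ico_tail_le` with `q′ = q − 1 ≥ 1` (§1) — the old half against the `(1+q)`-tail `≤ 1`),
and the summed tail `Σ_{i<N} τ(i+1) ≤ T₀∕(q−1)` for the second file's cutoff-threshold variant.  §3 reads off the rate for the whole class and
pairs it with generation 49's minorant side (`…RateUniform.powerTail_rate_lower_pointwise`, valid for every `q ≥ 0`).  The fourth file does
the power PROFILES `ρ(a) = M₀∕(a+1)^{1+q}`, every `q ≥ 1`.  Nothing of Bałaban's (1.22) is asserted or constructed; row D4 class UNCHANGED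
(critical-path width 0; instance 0∕1; D4 DISCHARGE NO DATE); NOT B12 Thm 2, NOT BetaPertH, NOT continuum, NOT Clay.  HONEST DEPENDENCY:
continuum YM on T⁴ ⇐ BetaPertH ∧ nine spine estimates (0/9 proved); BetaPertH ⇐ (D1) ∧ (D4) ∧ CAP+tail; G-an2-4 gates asym, D1 and NE2/3/4.
ABSOLUTE RULE: nothing is cited as a fact.

WHAT IS PROVED ([folklore]; 0 sorry; 0 `def`; Mathlib + the station only).
* §1 **`sum_rpow_le_of_one_lt_all`** (`Σ_{i<N} 1∕(i+1)^q ≤ 1 + 1∕(q−1)`, every `q > 1`), `sum_rpow_shift_le` (`Σ_{i<N} 1∕(i+2)^q ≤ 1∕(q−1)`).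
* §2 **`powerTailAll_T2`** (`A₂ = T₀·2^q·(2 + 1∕(q−1))`, every `q > 1`), **`powerTailAll_Ts`** (`Σ_{i<N} T₀∕(i+2)^q ≤ T₀∕(q−1)`).
* §3 **`powerTailAll_rate`** (`2Wγ < b`; `C_wA₂ ≤ b√b√m` ⇒ for ALL `n`: `0 ≤ astar g m − invSq g m n ≤ (4C_w∕√b)√m·T₀∕(n+2)^q`),
  **`powerTailAll_rate_tail`** (`Wγ < b`; `2A₂ ≤ b√b√m`, `2√2T₀∕(q−1) ≤ (1−Wγ∕b)b√b·m√m` ⇒ for ALL `n`: `… ≤ (8∕√b)√m·T₀∕(n+2)^q`),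
  `powerTailAll_rate_uniform_tail` (below the threshold, `m ≤ σ₀ ≤ n+m`), **`powerTailAll_two_sided`** (with a minorant `T₁∕(k+1)^q`, `Wγ < b`,
  `1 ≤ m ≤ n+1`: `√m·T₁∕(n+m+1)^q ≤ 8κ₂√b₂(1+Wγ∕b)(astar g m − invSq g m n)∕(1−Wγ∕b)` AND `astar g m − invSq g m n ≤ (8∕√b)√m·T₀∕(n+2)^q`
  at the SAME `m`).
All letters NOT-IN-PRINT; `BetaFlowAsPrinted S` records a Markov β_n only ⇒ no junction of the as-printed interface changes.
-/

noncomputable section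

open Finset Filter Topology

namespace Summit.QuantumFields.BalabanUV.Beta.RemainderExplicitHistoryDiagonalRatePowerTailAll

open Literature.MathematicalPhysics.QuantumFieldTheory.Balaban1983to89
open Literature.MathematicalPhysics.QuantumFieldTheory.Balaban1983to89.FlowStep
open Literature.MathematicalPhysics.QuantumFieldTheory.Balaban1983to89.T4CouplingMatching
open Literature.MathematicalPhysics.QuantumFieldTheory.Balaban1983to89.T4ContinuumCoupling
open Summit.QuantumFields.BalabanUV.Beta.RemainderExplicitHistoryDiagonalRatePowerTail (powerTail_antitone)
open Summit.QuantumFields.BalabanUV.Beta.RemainderExplicitHistoryDiagonalRateUniform (powerTail_rate_lower_pointwise)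
open Summit.QuantumFields.BalabanUV.Beta.RemainderExplicitHistoryDiagonalRatePowerTailTwo (sum_rpow_le_of_one_lt sum_tail_le_one)
open Summit.QuantumFields.BalabanUV.Beta.RemainderExplicitHistoryDiagonalRatePowerProfileTwo (sum_Ico_tail_le)
open Summit.QuantumFields.BalabanUV.Beta.RemainderExplicitHistoryDiagonalRateEverywhere

variable {β : HBeta} {b γ W : ℝ} {ρ : ℕ → ℝ}

/-! ## §1 The convergent `q`-series for every `q > 1` -/

/-- `Σ_{i<N} 1∕(i+1)^q ≤ 1 + 1∕(q−1)` for EVERY `q > 1`: for `q ≤ 2` generation 50's `sum_rpow_le_of_one_lt` (Bernoulli with exponent `q − 1 ≤ 1`);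
for `q ≥ 2` the term `i = 0` plus `…RatePowerProfileTwo.sum_Ico_tail_le` with the exponent `q − 1 ≥ 1` from `k = 1`
(`1∕((a+1)^{q−1}(a+1)) = 1∕(a+1)^q`). [folklore] -/
theorem sum_rpow_le_of_one_lt_all {q : ℝ} (hq1 : 1 < q) (N : ℕ) :
    ∑ i ∈ range N, 1 / ((i : ℝ) + 1) ^ q ≤ 1 + 1 / (q - 1) := by
  have hq1' : 0 < q - 1 := by linarith
  rcases le_or_gt q 2 with hq2 | hq2
  · exact sum_rpow_le_of_one_lt hq1 hq2 N
  cases N with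
  | zero => rw [Finset.sum_range_zero]; positivity
  | succ N =>
    rw [Finset.range_eq_Ico, Finset.sum_eq_sum_Ico_succ_bot (Nat.succ_pos N)]
    have h0 : 1 / ((((0 : ℕ) : ℝ)) + 1) ^ q = 1 := by simp
    rw [h0]
    have ht := sum_Ico_tail_le (q := q - 1) (by linarith) (k := 1) (N := N + 1) le_rfl (by omega)
    simp only [Nat.cast_one, Real.one_rpow, mul_one] at ht
    have e : ∀ a : ℕ, 1 / ((((a : ℝ) + 1) ^ (q - 1)) * ((a : ℝ) + 1)) = 1 / ((a : ℝ) + 1) ^ q := by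
      intro a
      have hx : (0 : ℝ) < (a : ℝ) + 1 := by positivity
      rw [Real.rpow_sub_one hx.ne', div_mul_cancel₀ _ hx.ne']
    rw [Finset.sum_congr rfl fun a _ => e a] at ht
    linarith

/-- THE SHIFTED `q`-SERIES: `Σ_{i<N} 1∕(i+2)^q ≤ 1∕(q−1)` for every `q > 1` (`sum_rpow_le_of_one_lt_all` at `N + 1`, minus the term `i = 0`). [folklore] -/
theorem sum_rpow_shift_le {q : ℝ} (hq1 : 1 < q) (N : ℕ) :
    ∑ i ∈ range N, 1 / ((i : ℝ) + 2) ^ q ≤ 1 / (q - 1) := by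
  have h := sum_rpow_le_of_one_lt_all hq1 (N + 1)
  rw [Finset.sum_range_succ'] at h
  have h0 : 1 / ((((0 : ℕ) : ℝ)) + 1) ^ q = 1 := by simp
  have e : ∀ i : ℕ, 1 / ((((i + 1 : ℕ) : ℝ)) + 1) ^ q = 1 / ((i : ℝ) + 2) ^ q := by
    intro i; push_cast; ring_nf
  rw [h0, Finset.sum_congr rfl fun i _ => e i] at h
  linarith

/-! ## §2 The convolution shape (T2) and the summed tail for `τ(k) = T₀∕(k+1)^q`, every `q > 1` -/

/-- SHAPE (T2) WITH `A₂ = T₀·2^q·(2 + 1∕(q−1))` for `τ(k) = T₀∕(k+1)^q`, EVERY `q > 1` (any real `T₀`):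
`Σ_{i<j₀} τ(i+1)τ(j₀−i)∕(j₀+1−i) ≤ T₀·2^q·(2 + 1∕(q−1))·τ(j₀+1)` — generation 50's split at `j₀∕2` with the factor `2^q` kept: young `i` have
`j₀+1−i ≥ (j₀+2)∕2` and the convergent `q`-series of §1, old `i` have `i+2 ≥ (j₀+2)∕2` and the `(1+q)`-tail `≤ 1`. [folklore] -/
theorem powerTailAll_T2 {T₀ q : ℝ} (hq1 : 1 < q) (j₀ : ℕ) :
    ∑ i ∈ range j₀, (T₀ / ((((i + 1 : ℕ) : ℝ)) + 1) ^ q) * (T₀ / ((((j₀ - i : ℕ) : ℝ)) + 1) ^ q)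
        / ((j₀ + 1 - i : ℕ) : ℝ)
      ≤ T₀ * (2 ^ q * (2 + 1 / (q - 1))) * (T₀ / ((((j₀ + 1 : ℕ) : ℝ)) + 1) ^ q) := by
  set h : ℕ := j₀ / 2 with hh
  have hq0 : 0 < q := by linarith
  have hq1' : 0 < q - 1 := by linarith
  set w : ℝ := (j₀ : ℝ) + 2 with hw
  have hw0 : 0 < w := by rw [hw]; positivity
  have hw2 : (2 : ℝ) ≤ w := by rw [hw]; have : (0 : ℝ) ≤ j₀ := Nat.cast_nonneg _; linarith
  have hwq : 0 < w ^ q := Real.rpow_pos_of_pos hw0 q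
  have h2q0 : 0 < (2 : ℝ) ^ q := Real.rpow_pos_of_pos (by norm_num) q
  have ej : (((j₀ + 1 : ℕ) : ℝ)) + 1 = w := by rw [hw]; push_cast; ring
  rw [ej]
  -- `(w∕2)^q = w^q ∕ 2^q`
  have ehalf : (w / 2) ^ q = w ^ q / 2 ^ q := Real.div_rpow hw0.le (by norm_num) q
  have hw2' : 0 < w / 2 := by positivity
  have hw2q : 0 < (w / 2) ^ q := Real.rpow_pos_of_pos hw2' q
  -- the two majorants
  set cA : ℝ := T₀ ^ 2 * (2 ^ q * 2 / (w ^ q * w)) with hcA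
  set cB : ℝ := T₀ ^ 2 * (2 ^ q / w ^ q) with hcB
  have hcA0 : 0 ≤ cA := by positivity
  have hcB0 : 0 ≤ cB := by positivity
  set fA : ℕ → ℝ := fun i => if i ≤ h then cA * (1 / ((i : ℝ) + 1) ^ q) else 0 with hfA
  set fB : ℕ → ℝ := fun i => cB * (1 / ((((j₀ + 1 - i : ℕ) : ℝ) ^ q) * ((j₀ + 1 - i : ℕ) : ℝ))) with hfB
  -- termwise
  have hterm : ∀ i ∈ range j₀, (T₀ / ((((i + 1 : ℕ) : ℝ)) + 1) ^ q) * (T₀ / ((((j₀ - i : ℕ) : ℝ)) + 1) ^ q)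
        / ((j₀ + 1 - i : ℕ) : ℝ) ≤ fA i + fB i := by
    intro i hi
    have hi' := Finset.mem_range.mp hi
    have ei : (((i + 1 : ℕ) : ℝ)) + 1 = (i : ℝ) + 2 := by push_cast; ring
    have ev : (((j₀ - i : ℕ) : ℝ)) + 1 = ((j₀ + 1 - i : ℕ) : ℝ) := by
      rw [show j₀ + 1 - i = (j₀ - i) + 1 by omega]; push_cast; ring
    rw [ei, ev]
    set v : ℝ := ((j₀ + 1 - i : ℕ) : ℝ) with hv
    have hv0 : (0 : ℝ) < v := by rw [hv]; exact_mod_cast (by omega : 0 < j₀ + 1 - i)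
    have hvq : 0 < v ^ q := Real.rpow_pos_of_pos hv0 q
    have hx : (0 : ℝ) < (i : ℝ) + 2 := by positivity
    have hxq : 0 < ((i : ℝ) + 2) ^ q := Real.rpow_pos_of_pos hx q
    have hx1 : (0 : ℝ) < (i : ℝ) + 1 := by positivity
    have hx1q : 0 < ((i : ℝ) + 1) ^ q := Real.rpow_pos_of_pos hx1 q
    have eterm : (T₀ / ((i : ℝ) + 2) ^ q) * (T₀ / v ^ q) / v = T₀ ^ 2 * (1 / ((i : ℝ) + 2) ^ q) * (1 / (v ^ q * v)) := by
      field_simp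
    rw [eterm]
    have hfA0 : 0 ≤ fA i := by simp only [hfA]; split_ifs <;> positivity
    have hfB0 : 0 ≤ fB i := by simp only [hfB]; positivity
    by_cases hih : i ≤ h
    · -- young: `v ≥ w∕2`
      have hvw : w / 2 ≤ v := by
        rw [hw, hv]
        have : (j₀ : ℝ) + 2 ≤ 2 * ((j₀ + 1 - i : ℕ) : ℝ) := by exact_mod_cast (by omega : j₀ + 2 ≤ 2 * (j₀ + 1 - i))
        linarith
      have hvv : (w / 2) ^ q * (w / 2) ≤ v ^ q * v :=
        mul_le_mul (Real.rpow_le_rpow hw2'.le hvw hq0.le) hvw hw2'.le hvq.le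
      have hA1 : 1 / (v ^ q * v) ≤ 1 / ((w / 2) ^ q * (w / 2)) :=
        one_div_le_one_div_of_le (mul_pos hw2q hw2') hvv
      have hA2 : 1 / ((w / 2) ^ q * (w / 2)) = 2 ^ q * 2 / (w ^ q * w) := by
        rw [ehalf]; field_simp
      have hA3 : 1 / ((i : ℝ) + 2) ^ q ≤ 1 / ((i : ℝ) + 1) ^ q :=
        one_div_le_one_div_of_le hx1q (Real.rpow_le_rpow hx1.le (by linarith) hq0.le)
      calc T₀ ^ 2 * (1 / ((i : ℝ) + 2) ^ q) * (1 / (v ^ q * v))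
          ≤ T₀ ^ 2 * (1 / ((i : ℝ) + 1) ^ q) * (2 ^ q * 2 / (w ^ q * w)) :=
            mul_le_mul (mul_le_mul_of_nonneg_left hA3 (by positivity)) (hA1.trans hA2.le) (by positivity) (by positivity)
        _ = fA i := by simp only [hfA, if_pos hih, hcA]; ring
        _ ≤ fA i + fB i := by linarith
    · -- old: `i + 2 ≥ w∕2`
      rw [not_le] at hih
      have hiw : w / 2 ≤ (i : ℝ) + 2 := by
        rw [hw]
        have : (j₀ : ℝ) < 2 * ((i : ℝ) + 1) := by exact_mod_cast (by omega : j₀ < 2 * (i + 1))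
        linarith
      have hB1 : 1 / ((i : ℝ) + 2) ^ q ≤ 1 / (w / 2) ^ q :=
        one_div_le_one_div_of_le hw2q (Real.rpow_le_rpow hw2'.le hiw hq0.le)
      have hB2 : 1 / (w / 2) ^ q = 2 ^ q / w ^ q := by rw [ehalf, one_div_div]
      calc T₀ ^ 2 * (1 / ((i : ℝ) + 2) ^ q) * (1 / (v ^ q * v))
          ≤ T₀ ^ 2 * (2 ^ q / w ^ q) * (1 / (v ^ q * v)) :=
            mul_le_mul_of_nonneg_right (mul_le_mul_of_nonneg_left (hB1.trans hB2.le) (by positivity)) (by positivity)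
        _ = fB i := by simp only [hfB, hcB, hv]
        _ ≤ fA i + fB i := by linarith
  -- the young half against the convergent `q`-series
  have hA : ∑ i ∈ range j₀, fA i ≤ cA * (1 + 1 / (q - 1)) := by
    have hsub : ∑ i ∈ range j₀, fA i ≤ ∑ i ∈ range (h + 1), cA * (1 / ((i : ℝ) + 1) ^ q) := by
      calc ∑ i ∈ range j₀, fA i = ∑ i ∈ (range j₀).filter (fun i => i ≤ h), cA * (1 / ((i : ℝ) + 1) ^ q) := by
            rw [Finset.sum_filter]
        _ ≤ ∑ i ∈ range (h + 1), cA * (1 / ((i : ℝ) + 1) ^ q) := by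
            refine Finset.sum_le_sum_of_subset_of_nonneg ?_ fun i _ _ => by positivity
            intro i hi
            have := (Finset.mem_filter.mp hi).2
            exact Finset.mem_range.mpr (by omega)
    have hhead := sum_rpow_le_of_one_lt_all hq1 (h + 1)
    calc ∑ i ∈ range j₀, fA i ≤ ∑ i ∈ range (h + 1), cA * (1 / ((i : ℝ) + 1) ^ q) := hsub
      _ = cA * ∑ i ∈ range (h + 1), 1 / ((i : ℝ) + 1) ^ q := by rw [Finset.mul_sum]
      _ ≤ cA * (1 + 1 / (q - 1)) := mul_le_mul_of_nonneg_left hhead hcA0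
  -- the old half against the `(1+q)`-tail, reflected
  have hB : ∑ i ∈ range j₀, fB i ≤ cB * 1 := by
    have hrefl : ∑ i ∈ range j₀, 1 / ((((j₀ + 1 - i : ℕ) : ℝ) ^ q) * ((j₀ + 1 - i : ℕ) : ℝ))
        = ∑ t ∈ range j₀, 1 / ((((t : ℝ) + 2) ^ q) * ((t : ℝ) + 2)) := by
      rw [← Finset.sum_range_reflect (fun t : ℕ => 1 / ((((t : ℝ) + 2) ^ q) * ((t : ℝ) + 2))) j₀]
      refine Finset.sum_congr rfl fun i hi => ?_
      have hi' := Finset.mem_range.mp hi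
      have e : ((j₀ + 1 - i : ℕ) : ℝ) = ((j₀ - 1 - i : ℕ) : ℝ) + 2 := by
        rw [show j₀ + 1 - i = (j₀ - 1 - i) + 2 by omega]; push_cast; ring
      rw [e]
    calc ∑ i ∈ range j₀, fB i = cB * ∑ i ∈ range j₀, 1 / ((((j₀ + 1 - i : ℕ) : ℝ) ^ q) * ((j₀ + 1 - i : ℕ) : ℝ)) := by
          rw [Finset.mul_sum]
      _ ≤ cB * 1 := by rw [hrefl]; exact mul_le_mul_of_nonneg_left (sum_tail_le_one hq1.le j₀) hcB0
  have hsum2 : ∑ i ∈ range j₀, (fA i + fB i) ≤ cA * (1 + 1 / (q - 1)) + cB * 1 := by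
    rw [Finset.sum_add_distrib]; exact add_le_add hA hB
  refine ((Finset.sum_le_sum hterm).trans hsum2).trans ?_
  -- algebra: `cA·Z = T₀²2^q·Z·(2∕w)∕w^q ≤ T₀²2^q·Z∕w^q` (`w ≥ 2`), `cB = T₀²2^q∕w^q`, `Z + 1 = 2 + 1∕(q−1)`
  have hZ0 : 0 < 1 + 1 / (q - 1) := by positivity
  have e1 : cA * (1 + 1 / (q - 1)) = (T₀ ^ 2 * 2 ^ q * (1 + 1 / (q - 1)) / w ^ q) * (2 / w) := by
    simp only [hcA]; field_simp
  have e2 : cB * 1 = T₀ ^ 2 * 2 ^ q / w ^ q := by simp only [hcB]; ring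
  have h2w : 2 / w ≤ 1 := by rw [div_le_one hw0]; exact hw2
  have h3 : (T₀ ^ 2 * 2 ^ q * (1 + 1 / (q - 1)) / w ^ q) * (2 / w) ≤ T₀ ^ 2 * 2 ^ q * (1 + 1 / (q - 1)) / w ^ q :=
    mul_le_of_le_one_right (by positivity) h2w
  rw [e1, e2]
  calc (T₀ ^ 2 * 2 ^ q * (1 + 1 / (q - 1)) / w ^ q) * (2 / w) + T₀ ^ 2 * 2 ^ q / w ^ q
      ≤ T₀ ^ 2 * 2 ^ q * (1 + 1 / (q - 1)) / w ^ q + T₀ ^ 2 * 2 ^ q / w ^ q := by linarith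
    _ = T₀ * (2 ^ q * (2 + 1 / (q - 1))) * (T₀ / w ^ q) := by field_simp; ring

/-- THE SUMMED TAIL: `Σ_{i<N} T₀∕((i+1)+1)^q ≤ T₀∕(q−1)` for `q > 1`, `T₀ ≥ 0` (`sum_rpow_shift_le`) — the hypothesis `Ts` of the second file's
cutoff-threshold variant. [folklore] -/
theorem powerTailAll_Ts {T₀ q : ℝ} (hq1 : 1 < q) (hT₀ : 0 ≤ T₀) (N : ℕ) :
    ∑ i ∈ range N, T₀ / ((((i + 1 : ℕ) : ℝ)) + 1) ^ q ≤ T₀ / (q - 1) := by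
  have e : ∀ i : ℕ, T₀ / ((((i + 1 : ℕ) : ℝ)) + 1) ^ q = T₀ * (1 / ((i : ℝ) + 2) ^ q) := by
    intro i; push_cast; rw [show (i : ℝ) + 1 + 1 = (i : ℝ) + 2 by ring]; ring
  rw [Finset.sum_congr rfl fun i _ => e i, ← Finset.mul_sum]
  calc T₀ * ∑ i ∈ range N, 1 / ((i : ℝ) + 2) ^ q ≤ T₀ * (1 / (q - 1)) := mul_le_mul_of_nonneg_left (sum_rpow_shift_le hq1 N) hT₀
    _ = T₀ / (q - 1) := by ring

/-! ## §3 The rate for every summable power tail -/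

/-- **ROAD P3 — THE RATE IN THE CUTOFF FOR EVERY POWER TAIL `q > 1`, AT EVERY DISTANCE AND CUTOFF** (box-type smallness).  A pinned family of runs
of the order-0 profile family in ]0,γ] (`b > 0`, `γ > 0`, `ρ ≥ 0`, `Σ_{a<N} ρ_a ≤ W`, `2Wγ < b`) whose profile has the tail majorant `R(N) − R(k) ≤
T₀∕(k+1)^q`, `q > 1`, `T₀ ≥ 0`; `C_w = (1−Wγ∕b)∕(1−2Wγ∕b)`.  THEN for every `m` with `C_w·T₀·2^q(2 + 1∕(q−1)) ≤ b√b·√m` and EVERY cutoff `n`: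
`0 ≤ astar g m − invSq g m n ≤ (4C_w∕√b)·√m·T₀∕(n+2)^q` — the second file's `astar_sub_invSq_le_rate_everywhere` with `powerTailAll_T2`.  For `q ≥ 2`
this is generation 50's census OPEN (ii′); for `q < 2` it is generations 49–50's rate WITHOUT (T1) and WITHOUT `m ≤ n + 1`.
[cite: Balaban1987RG1, (0.20) p.256, (0.31) and Thm 2 p.259] -/
theorem powerTailAll_rate {T₀ q : ℝ}
    (hβ : ∀ (k : ℕ) (p : Fin (k + 1) → ℝ),
      β k p = b + ∑ i : Fin (k + 1), ρ (k - i) * min (p (Fin.last k)) (|p (Fin.last k) - p i|))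
    (hb : 0 < b) (hγ : 0 < γ) (hρ0 : ∀ a, 0 ≤ ρ a) (hρW : ∀ n, ∑ a ∈ range n, ρ a ≤ W) (hsmall2 : 2 * W * γ < b)
    (hq1 : 1 < q) (hT₀ : 0 ≤ T₀)
    (hτ : ∀ k N : ℕ, k ≤ N → ∑ a ∈ range N, ρ a - ∑ a ∈ range k, ρ a ≤ T₀ / ((k : ℝ) + 1) ^ q)
    {g : ℕ → ℕ → ℝ} {gIR : ℝ} (hrun : ∀ K, RGEqH K β (g K)) (hbox : ∀ K i, i ≤ K → 0 < g K i ∧ g K i ≤ γ)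
    (hpin : ∀ K, g K K = gIR) {m : ℕ}
    (hm : (1 - W * γ / b) / (1 - 2 * W * γ / b) * (T₀ * (2 ^ q * (2 + 1 / (q - 1)))) ≤ b * Real.sqrt b * Real.sqrt (m : ℝ))
    (n : ℕ) :
    0 ≤ astar g m - invSq g m n ∧ astar g m - invSq g m n
      ≤ 4 * ((1 - W * γ / b) / (1 - 2 * W * γ / b)) / Real.sqrt b * Real.sqrt (m : ℝ) * (T₀ / ((((n + 1 : ℕ) : ℝ)) + 1) ^ q) :=
  astar_sub_invSq_le_rate_everywhere (τ := fun k => T₀ / ((k : ℝ) + 1) ^ q) (A₂ := T₀ * (2 ^ q * (2 + 1 / (q - 1))))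
    hβ hb hγ hρ0 hρW hsmall2 (fun k => by positivity) (fun _ _ hkl => powerTail_antitone hT₀ (by linarith) hkl) hτ
    (fun j₀ => powerTailAll_T2 hq1 j₀) hrun hbox hpin hm n

/-- **THE SAME UNDER `Wγ < b` ABOVE THE CUTOFF THRESHOLD**: `2T₀·2^q(2 + 1∕(q−1)) ≤ b√b·√m` and `2√2·T₀∕(q−1) ≤ (1−Wγ∕b)·b√b·m√m` ⇒ for EVERY cutoff
`n`: `0 ≤ astar g m − invSq g m n ≤ (8∕√b)·√m·T₀∕(n+2)^q` (the second file's `astar_sub_invSq_le_rate_everywhere_tail` with `powerTailAll_T2` and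
`powerTailAll_Ts`). [cite: Balaban1987RG1, (0.20) p.256, (0.31) and Thm 2 p.259] -/
theorem powerTailAll_rate_tail {T₀ q : ℝ}
    (hβ : ∀ (k : ℕ) (p : Fin (k + 1) → ℝ),
      β k p = b + ∑ i : Fin (k + 1), ρ (k - i) * min (p (Fin.last k)) (|p (Fin.last k) - p i|))
    (hb : 0 < b) (hγ : 0 < γ) (hρ0 : ∀ a, 0 ≤ ρ a) (hρW : ∀ n, ∑ a ∈ range n, ρ a ≤ W) (hsmall : W * γ < b)
    (hq1 : 1 < q) (hT₀ : 0 ≤ T₀)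
    (hτ : ∀ k N : ℕ, k ≤ N → ∑ a ∈ range N, ρ a - ∑ a ∈ range k, ρ a ≤ T₀ / ((k : ℝ) + 1) ^ q)
    {g : ℕ → ℕ → ℝ} {gIR : ℝ} (hrun : ∀ K, RGEqH K β (g K)) (hbox : ∀ K i, i ≤ K → 0 < g K i ∧ g K i ≤ γ)
    (hpin : ∀ K, g K K = gIR) {m : ℕ} (hm : 2 * (T₀ * (2 ^ q * (2 + 1 / (q - 1)))) ≤ b * Real.sqrt b * Real.sqrt (m : ℝ))
    (hmthr : 2 * Real.sqrt 2 * (T₀ / (q - 1)) ≤ (1 - W * γ / b) * (b * Real.sqrt b) * ((m : ℝ) * Real.sqrt (m : ℝ))) (n : ℕ) :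
    0 ≤ astar g m - invSq g m n ∧ astar g m - invSq g m n
      ≤ 8 / Real.sqrt b * Real.sqrt (m : ℝ) * (T₀ / ((((n + 1 : ℕ) : ℝ)) + 1) ^ q) :=
  astar_sub_invSq_le_rate_everywhere_tail (τ := fun k => T₀ / ((k : ℝ) + 1) ^ q) (A₂ := T₀ * (2 ^ q * (2 + 1 / (q - 1))))
    (Ts := T₀ / (q - 1)) hβ hb hγ hρ0 hρW hsmall (fun k => by positivity) (fun _ _ hkl => powerTail_antitone hT₀ (by linarith) hkl) hτ
    (fun N => powerTailAll_Ts hq1 hT₀ N) (fun j₀ => powerTailAll_T2 hq1 j₀) hrun hbox hpin hm hmthr n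

/-- **BELOW THE THRESHOLD DISTANCE, ONE CONSTANT** (`Wγ < b`): thresholds at `σ₀`; for every `m ≤ σ₀` and `n` with `σ₀ ≤ n + m`:
`0 ≤ astar g m − invSq g m n ≤ (8∕√b)·√σ₀·T₀∕(n+m+2−σ₀)^q ∕ (1 − Wγ∕b)`. [cite: Balaban1987RG1, (0.20) p.256, (0.31) and Thm 2 p.259] -/
theorem powerTailAll_rate_uniform_tail {T₀ q : ℝ}
    (hβ : ∀ (k : ℕ) (p : Fin (k + 1) → ℝ),
      β k p = b + ∑ i : Fin (k + 1), ρ (k - i) * min (p (Fin.last k)) (|p (Fin.last k) - p i|))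
    (hb : 0 < b) (hγ : 0 < γ) (hρ0 : ∀ a, 0 ≤ ρ a) (hρW : ∀ n, ∑ a ∈ range n, ρ a ≤ W) (hsmall : W * γ < b)
    (hq1 : 1 < q) (hT₀ : 0 ≤ T₀)
    (hτ : ∀ k N : ℕ, k ≤ N → ∑ a ∈ range N, ρ a - ∑ a ∈ range k, ρ a ≤ T₀ / ((k : ℝ) + 1) ^ q)
    {g : ℕ → ℕ → ℝ} {gIR : ℝ} (hrun : ∀ K, RGEqH K β (g K)) (hbox : ∀ K i, i ≤ K → 0 < g K i ∧ g K i ≤ γ)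
    (hpin : ∀ K, g K K = gIR) {σ₀ m n : ℕ} (hσ₀ : 2 * (T₀ * (2 ^ q * (2 + 1 / (q - 1)))) ≤ b * Real.sqrt b * Real.sqrt (σ₀ : ℝ))
    (hσthr : 2 * Real.sqrt 2 * (T₀ / (q - 1)) ≤ (1 - W * γ / b) * (b * Real.sqrt b) * ((σ₀ : ℝ) * Real.sqrt (σ₀ : ℝ)))
    (hmσ : m ≤ σ₀) (hn : σ₀ ≤ n + m) :
    0 ≤ astar g m - invSq g m n ∧ astar g m - invSq g m n
      ≤ 8 / Real.sqrt b * Real.sqrt (σ₀ : ℝ) * (T₀ / ((((n + m + 1 - σ₀ : ℕ) : ℝ)) + 1) ^ q) / (1 - W * γ / b) :=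
  astar_sub_invSq_le_rate_everywhere_uniform_tail (τ := fun k => T₀ / ((k : ℝ) + 1) ^ q) (A₂ := T₀ * (2 ^ q * (2 + 1 / (q - 1))))
    (Ts := T₀ / (q - 1)) hβ hb hγ hρ0 hρW hsmall (fun k => by positivity) (fun _ _ hkl => powerTail_antitone hT₀ (by linarith) hkl) hτ
    (fun N => powerTailAll_Ts hq1 hT₀ N) (fun j₀ => powerTailAll_T2 hq1 j₀) hrun hbox hpin hσ₀ hσthr hmσ hn

/-- **ROAD P3 — EVERY SUMMABLE POWER TAIL: THE RATE `√m∕n^q` IS TWO-SIDED AND POINTWISE** (`Wγ < b`).  Tail majorant `T₀∕(k+1)^q` and tail minorant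
`T₁∕(k+1)^q` on `[k, N)` for `N ≥ 2k`, `k ≥ 1` (`q > 1`, `T₀, T₁ ≥ 0`); thresholds `2T₀·2^q(2+1∕(q−1)) ≤ b√b√m`, `2√2T₀∕(q−1) ≤ (1−Wγ∕b)b√b·m√m`; then
for every cutoff `n` with `1 ≤ m ≤ n + 1` BOTH `√m·T₁∕(n+m+1)^q ≤ 8κ₂√b₂(1+Wγ∕b)·(astar g m − invSq g m n)∕(1−Wγ∕b)` (generation 50's
`…RateUniform.powerTail_rate_lower_pointwise`, every `q ≥ 0`) AND `astar g m − invSq g m n ≤ (8∕√b)√m·T₀∕(n+2)^q` (`powerTailAll_rate_tail`, where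
`m ≤ n + 1` is NOT needed) — the census line for `q ≥ 2`. [cite: Balaban1987RG1, (0.20) p.256, (0.31) and Thm 2 p.259] -/
theorem powerTailAll_two_sided {T₀ T₁ q : ℝ}
    (hβ : ∀ (k : ℕ) (p : Fin (k + 1) → ℝ),
      β k p = b + ∑ i : Fin (k + 1), ρ (k - i) * min (p (Fin.last k)) (|p (Fin.last k) - p i|))
    (hb : 0 < b) (hγ : 0 < γ) (hρ0 : ∀ a, 0 ≤ ρ a) (hρW : ∀ n, ∑ a ∈ range n, ρ a ≤ W) (hsmall : W * γ < b)
    (hq1 : 1 < q) (hT₀ : 0 ≤ T₀) (hT₁ : 0 ≤ T₁)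
    (hτ : ∀ k N : ℕ, k ≤ N → ∑ a ∈ range N, ρ a - ∑ a ∈ range k, ρ a ≤ T₀ / ((k : ℝ) + 1) ^ q)
    (hτ' : ∀ k N : ℕ, 1 ≤ k → 2 * k ≤ N → T₁ / ((k : ℝ) + 1) ^ q ≤ ∑ a ∈ range N, ρ a - ∑ a ∈ range k, ρ a)
    {g : ℕ → ℕ → ℝ} {gIR : ℝ} (hrun : ∀ K, RGEqH K β (g K)) (hbox : ∀ K i, i ≤ K → 0 < g K i ∧ g K i ≤ γ)
    (hpin : ∀ K, g K K = gIR) {m n : ℕ} (hm : 2 * (T₀ * (2 ^ q * (2 + 1 / (q - 1)))) ≤ b * Real.sqrt b * Real.sqrt (m : ℝ))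
    (hmthr : 2 * Real.sqrt 2 * (T₀ / (q - 1)) ≤ (1 - W * γ / b) * (b * Real.sqrt b) * ((m : ℝ) * Real.sqrt (m : ℝ)))
    (hm1 : 1 ≤ m) (hmn : m ≤ n + 1) :
    Real.sqrt (m : ℝ) * (T₁ / ((((n + m : ℕ) : ℝ)) + 1) ^ q)
        ≤ 8 * ((1 / gIR ^ 2 + (b + W * γ)) / b) * Real.sqrt (1 / gIR ^ 2 + (b + W * γ)) * (1 + W * γ / b)
          * ((astar g m - invSq g m n) / (1 - W * γ / b))
      ∧ astar g m - invSq g m n ≤ 8 / Real.sqrt b * Real.sqrt (m : ℝ) * (T₀ / ((((n + 1 : ℕ) : ℝ)) + 1) ^ q) :=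
  ⟨powerTail_rate_lower_pointwise hβ hb hγ hρ0 hρW hsmall (by linarith) hT₁ hτ' hrun hbox hpin hm1 hmn,
    (powerTailAll_rate_tail hβ hb hγ hρ0 hρW hsmall hq1 hT₀ hτ hrun hbox hpin hm hmthr n).2⟩

end Summit.QuantumFields.BalabanUV.Beta.RemainderExplicitHistoryDiagonalRatePowerTailAll

end
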